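import Summits.QuantumFields.YangMills.Theorems.FluctuationComparisonRegPrIntLS2BetaReadNesting
import Summits.QuantumFields.YangMills.Theorems.FluctuationComparisonRegPrIntLS2BetaCombPoincare
import Literature.MathematicalPhysics.QuantumFieldTheory.Balaban1983to89.B15Eq177GaugeInvariance
import Mathlib.Data.Int.Interval
import HarnessLib

/-!
# S2β · (c₁ KNIT, LETTER M-3) THE TORUS CELL CLASSES: (★)'s class data `cl n` = the gen-`n` block fibres of `T^{(0)}` (`b = L^d`), the `|rel| ≤ τ` boxes and their counts,
# `⌊·∕L⌋` is non-expansive on the torus, and THE READ-CELL COVER in the dock's own binder shape (`read`, `nb`, `top ⊆ R`, `κ = 5^d`, `ν = (2θ+5)^d·η`)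

Cell `ym3-torus` (YM ladder rung R3 = continuum `SU(2)` Yang–Mills on the three-torus at fixed lattice data — a RUNG: NOT d = 4, NOT infinite volume, NOT a mass gap,
NOT Clay).  Width seat `ym3-torus-px13` (gen 27); crux `stmt-QuantumFields-20520`, LINE g18-1 S2β, pairing lane; (SCT′-c)₁ road of record: CURL-AVG (✓A–F) ∘ px16 g23's
composed dilution kernel `exists_composedKernel` (K0)–(K5) ∘ ✓`…S2BetaComposedKernelDock.dock_of_kernel` (p831065) ∘ (★) ✓`…S2BetaCellMaximalSquareFunction` (p830704).
The dock is LATTICE-FREE: it quantifies class maps `cl : ℕ → X → Finset X` with (★)'s four hypotheses, support representatives `nb n y` (`#nb ≤ κ`,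
`hsupp : K n y q ≠ 0 → ∃ r ∈ nb n y, q ∈ cl n r`), read sets `read n i`, top representatives `top i ⊆ R` (`R` pairwise `cl m`-disjoint, multiplicity `ν`) and
`hread : y ∈ read n i → r ∈ nb n y → ∃ r₀ ∈ top i, r ∈ cl m r₀`.  THIS FILE instantiates all of it on ONE torus `T^{(0)}` of a generic `P : Params` (internal levels
`n ≤ m ≤ m_P + K_P`; the T³-family transport to ✓FILE 3′'s `READ′_t(B)` ∕ `bondShift` currency is the knit's, px16 g23), with the index type `ι` ABSTRACT (a finite type with
«endpoint cells» `ends i ⊆ T^{(m)}`, `#{i : e ∈ ends i} ≤ η`; for `ι` = the coarsest bonds, `ends B = {B.src, B.tgt}`, `η = 2d`) and the read thickness `θ` GENERIC (`θ = 2` is READ′):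
  `cl n x   := {x′ : blockIter (min n (m_P+K_P)) x′ = blockIter (min n (m_P+K_P)) x}`            (gen-`n` block fibre; constant above the standing range so that (★)'s `∀ n` holds),
  `nb n y   := embIter n '' {c ∈ T^{(n)} : ∀ κ, |rel (blockIter n y) c|_κ ≤ 2}`                  (px16 (K4)'s support box, as finest REPRESENTATIVES),
  `read n i := embIter n '' {Y ∈ T^{(n)} : ∃ z ∈ T^{(0)}, blockIter m z ∈ ends i ∧ ∀ κ, |rel (blockIter n z) Y|_κ ≤ θ}`   (READ′'s «within θ of a site blocking into the ends»),
  `top i    := embIter m '' {c₀ ∈ T^{(m)} : ∃ e ∈ ends i, ∀ κ, |rel e c₀|_κ ≤ θ + 2}`,   `R := embIter m '' T^{(m)}`.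
`--kind proof --supports stmt-QuantumFields-20520 --as helper`, count-neutral, DEFINITION-FREE (the five set-formers are spelled out in every statement; no `def`).

WHAT IS PROVED (sorry-free).
§1 (★)'s CLASS DATA: ★`mem_cl_self` (h_mem), ★`cl_eq_of_mem` (h_eq), ★`cl_subset_succ` (h_nest, lit ✓`blockIter_succ`), ★`card_cl_eq` ∕ ★★`card_cl_le` (h_card with `b = L^d`,
   ✓`…CombPoincare.card_filter_blockIter_eq`), `mem_cl_embIter_iff` (the class of a representative `embIter n c` is the fibre of `c`, lit ✓`blockIter_embIter`), `embIter_inj`,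
   ★`pairwiseDisjoint_cl_image_embIter` (hR).
§2 THE CIRCLE, GENERAL RADIUS: ★★`natAbs_rel_blockOf_le_of_le_mul` (`|rel z x|_ν ≤ k·L ⟹ |rel (blockOf z) (blockOf x)|_ν ≤ k`; px10 g25's ✓`natAbs_rel_blockOf_le_one` is `k = 1`,
   same proof with `k`), ★`natAbs_rel_blockOf_le` (`⌊·∕L⌋` is NON-EXPANSIVE: `≤ D ⟹ ≤ D`), ★`natAbs_rel_blockIter_mono` (iterated from level `n` to level `m′ ≥ n`).
§3 BOXES: ★★`card_box_le` (`#{s : ∀ κ, |rel c s|_κ ≤ τ} ≤ (2τ+1)^d`, via `s = transl c (rel c s)` and `Fintype.piFinset` of `Icc (−τ) τ`), ★`card_nb_le` (hnb: `κ = 5^d`),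
   ★`card_filter_mem_top_le` (hν: `ν = (2θ+5)^d·η`).
§4 THE COVER: ★★`exists_mem_nb_of_rel_le_two` (px16's (K4) ⟹ the dock's `hsupp`), ★`top_subset_R` (htop), ★★★`read_cover` (hread: `y ∈ read n i`, `r ∈ nb n y`, `n ≤ m` ⟹
   `∃ r₀ ∈ top i, r ∈ cl m r₀` — triangle inequality at level `n` (`θ + 2`), then §2's non-expansiveness up to level `m`).

HONEST.  Finite torus combinatorics over lit `Setup`∕`blockIter`∕`embIter`∕`rel`; nothing of Bałaban's analysis asserted; the composed kernel (K0)–(K5), the FLAT weights, the T³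
transport to READ′, (★)'s inequality itself, (SCT′-c)₁₂₃, (LIFT-LAD′), (TOP-LAD′), (ST′), (ST), LOC, AVG₂♭-ax_q, GAP♯∘ (`stub_uniformFibreGapOrbit`, registry 3732b7df UNTOUCHED, 0∕5), the
five REGISTERED stubs, S2β, crux 20520, 19936, 19200, `YM3TorusSU2` — NOT proved; rung R3 = SU(2) YM₃ on T³ — NOT d = 4, NOT infinite volume, NOT a mass gap, NOT Clay; the Yang–Mills
mass gap is NOT proved.  Axioms standard.

References: [Balaban1987RG1] CMP **109** (1987) (0.1)–(0.4) pp.251–253 (the lattices `T^{(j)}`, blocks `B^k(y)`); [Balaban1985Averaging] CMP **98** (1985) Prop. 4 (128)–(135) pp.37–38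
(the printed sup recursion the read sets serve).
-/

set_option autoImplicit false

open Finset

namespace Summit.QuantumFields.YangMills.Theorems.FluctuationComparisonRegPrIntLS2BetaTorusCellClasses

open Literature.MathematicalPhysics.QuantumFieldTheory.Balaban1983to89
open Literature.MathematicalPhysics.QuantumFieldTheory.Balaban1983to89.B14.Eq22Determines (blockIter blockIter_zero blockIter_succ)
open Literature.MathematicalPhysics.QuantumFieldTheory.Balaban1983to89.B15DeterminingSets (embIter)
open Literature.MathematicalPhysics.QuantumFieldTheory.Balaban1983to89.B15Eq177GaugeInvariance (blockIter_embIter)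
open Literature.MathematicalPhysics.QuantumFieldTheory.Balaban1983to89.B10Eq27TorusAxialLog (rel rel_apply transl transl_apply transl_rel)
open Summit.QuantumFields.YangMills.Theorems.FluctuationComparisonRegPrIntLS2BetaReadNesting (natAbs_rel_le_add natAbs_rel_comm)
open Summit.QuantumFields.YangMills.Theorems.FluctuationComparisonRegPrIntLS2BetaCombPoincare (card_filter_blockIter_eq)
open Summit.QuantumFields.YangMills.Theorems.StrongCouplingShape (natAbs_valMinAbs_intCast_le)

variable {P : Params}

/-! ## §1 (★)'s class data: the gen-`n` block fibres of `T^{(0)}` -/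

section Classes

/-- ★ **h_mem**: every finest site lies in its own gen-`n` class. [cite: Balaban1987RG1, (0.1) p.251] -/
theorem mem_cl_self (n : ℕ) (x : Site P 0) :
    x ∈ univ.filter (fun x' : Site P 0 => blockIter (min n (P.m + P.K)) x' = blockIter (min n (P.m + P.K)) x) := by
  simp

/-- ★ **h_eq**: the classes of two members coincide (each `cl n` is a partition). [cite: Balaban1987RG1, (0.1) p.251] -/
theorem cl_eq_of_mem (n : ℕ) (x y : Site P 0)
    (hy : y ∈ univ.filter (fun x' : Site P 0 => blockIter (min n (P.m + P.K)) x' = blockIter (min n (P.m + P.K)) x)) :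
    univ.filter (fun x' : Site P 0 => blockIter (min n (P.m + P.K)) x' = blockIter (min n (P.m + P.K)) y) =
      univ.filter (fun x' : Site P 0 => blockIter (min n (P.m + P.K)) x' = blockIter (min n (P.m + P.K)) x) := by
  simp only [mem_filter, mem_univ, true_and] at hy
  rw [hy]

/-- ★ **h_nest**: the gen-`n` class is inside the gen-`(n+1)` class (`blockIter (n+1) = blockOf ∘ blockIter n`; constant above the standing range). [cite: Balaban1987RG1, (0.3) p.252] -/
theorem cl_subset_succ (n : ℕ) (x : Site P 0) :
    univ.filter (fun x' : Site P 0 => blockIter (min n (P.m + P.K)) x' = blockIter (min n (P.m + P.K)) x) ⊆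
      univ.filter (fun x' : Site P 0 => blockIter (min (n + 1) (P.m + P.K)) x' = blockIter (min (n + 1) (P.m + P.K)) x) := by
  intro x' hx'
  simp only [mem_filter, mem_univ, true_and] at hx' ⊢
  by_cases h : n + 1 ≤ P.m + P.K
  · rw [min_eq_left h, blockIter_succ, blockIter_succ]
    rw [min_eq_left (by omega)] at hx'
    rw [hx']
  · rw [min_eq_right (by omega)]
    rw [min_eq_right (by omega)] at hx'
    exact hx'

/-- ★ **THE CLASS SIZE**: `#(cl n x) = (L^d)^{min n (m+K)}` (✓`card_filter_blockIter_eq`). [cite: Balaban1987RG1, (0.3) p.252] -/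
theorem card_cl_eq (n : ℕ) (x : Site P 0) :
    (univ.filter (fun x' : Site P 0 => blockIter (min n (P.m + P.K)) x' = blockIter (min n (P.m + P.K)) x)).card = (P.L ^ P.d) ^ (min n (P.m + P.K)) :=
  card_filter_blockIter_eq (min_le_right _ _) _

/-- ★★ **h_card** with `b = L^d`: `#(cl n x) ≤ (L^d)^n`. [cite: Balaban1987RG1, (0.3) p.252] -/
theorem card_cl_le (n : ℕ) (x : Site P 0) :
    (univ.filter (fun x' : Site P 0 => blockIter (min n (P.m + P.K)) x' = blockIter (min n (P.m + P.K)) x)).card ≤ (P.L ^ P.d) ^ n := by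
  rw [card_cl_eq]
  exact Nat.pow_le_pow_right (pow_pos P.L_pos _) (min_le_left _ _)

/-- `embIter n` is injective in the standing range (left inverse `blockIter n`). [cite: Balaban1987RG1, (0.1) p.251] -/
theorem embIter_inj {n : ℕ} (hn : n ≤ P.m + P.K) {c c' : Site P n} (h : embIter n c = embIter n c') : c = c' := by
  rw [← blockIter_embIter n hn c, ← blockIter_embIter n hn c', h]

/-- **THE CLASS OF A REPRESENTATIVE IS A FIBRE**: `q ∈ cl n (embIter n c) ↔ blockIter n q = c` (`n` in the standing range). [cite: Balaban1987RG1, (0.1) p.251] -/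
theorem mem_cl_embIter_iff {n : ℕ} (hn : n ≤ P.m + P.K) (c : Site P n) (q : Site P 0) :
    q ∈ univ.filter (fun x' : Site P 0 => blockIter (min n (P.m + P.K)) x' = blockIter (min n (P.m + P.K)) (embIter n c)) ↔ blockIter n q = c := by
  rw [mem_filter, min_eq_left hn, blockIter_embIter n hn]
  simp

/-- ★ **hR**: the gen-`m` classes of distinct representatives `embIter m c` are pairwise disjoint (they are distinct fibres of `blockIter m`). [cite: Balaban1987RG1, (0.1) p.251] -/
theorem pairwiseDisjoint_cl_image_embIter {m : ℕ} (hm : m ≤ P.m + P.K) (S : Finset (Site P m)) :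
    ((S.image (embIter m) : Finset (Site P 0)) : Set (Site P 0)).PairwiseDisjoint
      (fun r => univ.filter (fun x' : Site P 0 => blockIter (min m (P.m + P.K)) x' = blockIter (min m (P.m + P.K)) r)) := by
  intro r hr r' hr' hne
  rw [Finset.coe_image] at hr hr'
  obtain ⟨c, -, rfl⟩ := hr
  obtain ⟨c', -, rfl⟩ := hr'
  rw [Function.onFun, Finset.disjoint_left]
  intro q hq hq'
  rw [mem_cl_embIter_iff hm] at hq hq'
  exact hne (by rw [← hq, hq'])

end Classes

/-! ## §2 The circle at general radius: `⌊·∕L⌋` is `1∕L`-Lipschitz up to rounding, hence non-expansive, on the torus -/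

section Circle

variable {j : ℕ}

/-- ★★ **`|rel z x|_ν ≤ k·L ⟹ |rel (blockOf z) (blockOf x)|_ν ≤ k`** (torus wrap-around included: the fine period is `L` times the coarse one).  px10 g25's
✓`natAbs_rel_blockOf_le_one` is the case `k = 1`; the proof is the same with `k`. [cite: Balaban1987RG1, (0.1)-(0.3) p.251-252] -/
theorem natAbs_rel_blockOf_le_of_le_mul (hj : j + 1 ≤ P.m + P.K) (z x : Site P j) (ν : Fin P.d) (k : ℕ)
    (h : (rel z x ν).natAbs ≤ k * P.L) : (rel (blockOf z) (blockOf x) ν).natAbs ≤ k := by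
  -- adapted from ✓`…S2BetaReadNesting.natAbs_rel_blockOf_le_one` (px10 g25), `1·L ↦ k·L`
  have hN : P.sitesPerDir j = P.sitesPerDir (j + 1) * P.L := P.sitesPerDir_eq_mul_succ hj
  have hL0 : (0 : ℤ) < P.L := by exact_mod_cast P.L_pos
  obtain ⟨hδ1, hδ2⟩ : -((k : ℤ) * P.L) ≤ rel z x ν ∧ rel z x ν ≤ (k : ℤ) * P.L := by
    have h' : |rel z x ν| ≤ (k : ℤ) * P.L := by rw [Int.abs_eq_natAbs]; exact_mod_cast h
    exact abs_le.mp h'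
  have hxz : x ν = z ν + ((rel z x ν : ℤ) : ZMod (P.sitesPerDir j)) := by
    rw [rel_apply, ZMod.coe_valMinAbs]; ring
  have hmod : (((x ν).val : ℤ) : ZMod (P.sitesPerDir j)) = ((((z ν).val : ℤ) + rel z x ν : ℤ) : ZMod (P.sitesPerDir j)) := by
    push_cast
    rw [ZMod.natCast_zmod_val, ZMod.natCast_zmod_val, hxz]
  rw [ZMod.intCast_eq_intCast_iff] at hmod
  obtain ⟨q, hq⟩ : ∃ q : ℤ, ((x ν).val : ℤ) = ((z ν).val : ℤ) + rel z x ν + (P.sitesPerDir j : ℤ) * q := by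
    obtain ⟨c, hc⟩ := Int.modEq_iff_dvd.mp hmod
    exact ⟨-c, by rw [mul_neg]; linarith⟩
  have hbx : (blockOf x) ν = ((((x ν).val : ℤ) / (P.L : ℤ) : ℤ) : ZMod (P.sitesPerDir (j + 1))) := by
    rw [← ZMod.natCast_zmod_val ((blockOf x) ν), Site.val_blockOf hj x ν, ← Int.natCast_div, Int.cast_natCast]
  have hbz : (blockOf z) ν = ((((z ν).val : ℤ) / (P.L : ℤ) : ℤ) : ZMod (P.sitesPerDir (j + 1))) := by
    rw [← ZMod.natCast_zmod_val ((blockOf z) ν), Site.val_blockOf hj z ν, ← Int.natCast_div, Int.cast_natCast]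
  have hdivx : ((x ν).val : ℤ) / (P.L : ℤ) = (((z ν).val : ℤ) + rel z x ν) / (P.L : ℤ) + (P.sitesPerDir (j + 1) : ℤ) * q := by
    have hNz : (P.sitesPerDir j : ℤ) = (P.sitesPerDir (j + 1) : ℤ) * (P.L : ℤ) := by exact_mod_cast hN
    rw [hq, hNz]
    rw [show ((z ν).val : ℤ) + rel z x ν + (P.sitesPerDir (j + 1) : ℤ) * (P.L : ℤ) * q =
        (((z ν).val : ℤ) + rel z x ν) + ((P.sitesPerDir (j + 1) : ℤ) * q) * (P.L : ℤ) by ring,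
      Int.add_mul_ediv_right _ _ hL0.ne']
  set A : ℤ := (((z ν).val : ℤ) + rel z x ν) / (P.L : ℤ) with hA
  set C : ℤ := ((z ν).val : ℤ) / (P.L : ℤ) with hC
  have hdiff : (blockOf x) ν - (blockOf z) ν = (((A - C : ℤ)) : ZMod (P.sitesPerDir (j + 1))) := by
    rw [hbx, hbz, hdivx]; push_cast; rw [ZMod.natCast_self]; ring
  have hr1 : A ≤ C + k := by
    calc A ≤ (((z ν).val : ℤ) + (k : ℤ) * (P.L : ℤ)) / (P.L : ℤ) := Int.ediv_le_ediv hL0 (by linarith)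
      _ = C + k := Int.add_mul_ediv_right _ _ hL0.ne'
  have hr2 : C - k ≤ A := by
    calc C - k = (((z ν).val : ℤ) + (-(k : ℤ)) * (P.L : ℤ)) / (P.L : ℤ) := by rw [Int.add_mul_ediv_right _ _ hL0.ne']; ring
      _ ≤ A := Int.ediv_le_ediv hL0 (by linarith)
  rw [rel_apply, hdiff]
  calc (((A - C : ℤ) : ZMod (P.sitesPerDir (j + 1))).valMinAbs).natAbs ≤ (A - C).natAbs := natAbs_valMinAbs_intCast_le _ _
    _ ≤ k := by
        have h3 : ((A - C).natAbs : ℤ) ≤ k := by rw [Int.natCast_natAbs]; exact abs_le.mpr ⟨by linarith, by linarith⟩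
        exact_mod_cast h3

/-- ★ **`⌊·∕L⌋` IS NON-EXPANSIVE ON THE TORUS**: `|rel z x|_ν ≤ D ⟹ |rel (blockOf z) (blockOf x)|_ν ≤ D` (`D ≤ D·L`). [cite: Balaban1987RG1, (0.1)-(0.3) p.251-252] -/
theorem natAbs_rel_blockOf_le (hj : j + 1 ≤ P.m + P.K) (z x : Site P j) (ν : Fin P.d) {D : ℕ}
    (h : (rel z x ν).natAbs ≤ D) : (rel (blockOf z) (blockOf x) ν).natAbs ≤ D :=
  natAbs_rel_blockOf_le_of_le_mul hj z x ν D (h.trans (Nat.le_mul_of_pos_right D P.L_pos))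

/-- ★ **ITERATED**: a coordinate bound on the relative position of two gen-`n` ancestors persists for all gen-`m′` ancestors, `n ≤ m′ ≤ m + K`. [cite: Balaban1987RG1, (0.1)-(0.3) p.251-252] -/
theorem natAbs_rel_blockIter_mono {n m' : ℕ} (hnm : n ≤ m') (hm' : m' ≤ P.m + P.K) (y q : Site P 0) (ν : Fin P.d) {D : ℕ}
    (h : (rel (blockIter n y) (blockIter n q) ν).natAbs ≤ D) : (rel (blockIter m' y) (blockIter m' q) ν).natAbs ≤ D := by
  induction hnm with
  | refl => exact h
  | step hle ih =>
      rw [blockIter_succ, blockIter_succ]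
      exact natAbs_rel_blockOf_le (by omega) _ _ ν (ih (by omega))

end Circle

/-! ## §3 Boxes `{s : ∀ κ, |rel c s|_κ ≤ τ}` and their counts -/

section Boxes

variable {j : ℕ}

/-- ★★ **A `|rel| ≤ τ` BOX HAS AT MOST `(2τ+1)^d` SITES** (it is the image of the integer cube `[−τ, τ]^d` under `v ↦ c + v`, since `s = c + rel c s`). [folklore] -/
theorem card_box_le (c : Site P j) (τ : ℕ) :
    (univ.filter (fun s : Site P j => ∀ κ, (rel c s κ).natAbs ≤ τ)).card ≤ (2 * τ + 1) ^ P.d := by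
  classical
  have hsub : univ.filter (fun s : Site P j => ∀ κ, (rel c s κ).natAbs ≤ τ) ⊆
      (Fintype.piFinset (fun _ : Fin P.d => Finset.Icc (-(τ : ℤ)) τ)).image (fun v => transl c v) := by
    intro s hs
    rw [mem_filter] at hs
    rw [mem_image]
    refine ⟨rel c s, ?_, transl_rel c s⟩
    rw [Fintype.mem_piFinset]
    intro κ
    rw [Finset.mem_Icc]
    have h1 : ((rel c s κ).natAbs : ℤ) ≤ τ := by exact_mod_cast hs.2 κ
    rw [Int.natCast_natAbs] at h1
    exact abs_le.mp h1
  refine (card_le_card hsub).trans (card_image_le.trans ?_)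
  rw [Fintype.card_piFinset, prod_const, card_univ, Fintype.card_fin, Int.card_Icc]
  apply le_of_eq
  congr 1
  omega

/-- ★ **hnb** (`κ = 5^d`): the support box of representatives has at most `5^d` members. [folklore] -/
theorem card_nb_le (n : ℕ) (y : Site P 0) :
    ((univ.filter (fun c : Site P n => ∀ κ, (rel (blockIter n y) c κ).natAbs ≤ 2)).image (embIter n)).card ≤ 5 ^ P.d :=
  card_image_le.trans (by simpa using card_box_le (blockIter n y) 2)

/-- ★ **hν** (`ν = (2θ+5)^d·η`): a gen-`m` representative `embIter m c₀` belongs to `top i` for at most `(2(θ+2)+1)^d·η` indices `i`, if every site of `T^{(m)}` is an endpoint cell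
of at most `η` indices. [folklore] -/
theorem card_filter_mem_top_le {m : ℕ} (hm : m ≤ P.m + P.K) {ι : Type*} [Fintype ι] (ends : ι → Finset (Site P m)) (θ η : ℕ)
    (hends : ∀ e : Site P m, (univ.filter (fun i : ι => e ∈ ends i)).card ≤ η) (c₀ : Site P m) :
    (univ.filter (fun i : ι => embIter m c₀ ∈
        (univ.filter (fun c : Site P m => ∃ e ∈ ends i, ∀ κ, (rel e c κ).natAbs ≤ θ + 2)).image (embIter m))).card ≤
      (2 * (θ + 2) + 1) ^ P.d * η := by
  classical
  -- `embIter m c₀ ∈ top i ↔ ∃ e ∈ ends i` in the box of `c₀`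
  have hsub : univ.filter (fun i : ι => embIter m c₀ ∈
        (univ.filter (fun c : Site P m => ∃ e ∈ ends i, ∀ κ, (rel e c κ).natAbs ≤ θ + 2)).image (embIter m)) ⊆
      (univ.filter (fun e : Site P m => ∀ κ, (rel c₀ e κ).natAbs ≤ θ + 2)).biUnion (fun e => univ.filter (fun i : ι => e ∈ ends i)) := by
    intro i hi
    rw [mem_filter, mem_image] at hi
    obtain ⟨c, hc, hcc⟩ := hi.2
    have hc0 : c = c₀ := embIter_inj hm hcc
    subst hc0
    rw [mem_filter] at hc
    obtain ⟨e, he, hrel⟩ := hc.2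
    rw [mem_biUnion]
    refine ⟨e, ?_, by rw [mem_filter]; exact ⟨mem_univ _, he⟩⟩
    rw [mem_filter]
    exact ⟨mem_univ _, fun κ => by rw [natAbs_rel_comm]; exact hrel κ⟩
  refine (card_le_card hsub).trans (card_biUnion_le.trans ?_)
  calc ∑ e ∈ univ.filter (fun e : Site P m => ∀ κ, (rel c₀ e κ).natAbs ≤ θ + 2), (univ.filter (fun i : ι => e ∈ ends i)).card
      ≤ ∑ _e ∈ univ.filter (fun e : Site P m => ∀ κ, (rel c₀ e κ).natAbs ≤ θ + 2), η := sum_le_sum fun e _ => hends e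
    _ = (univ.filter (fun e : Site P m => ∀ κ, (rel c₀ e κ).natAbs ≤ θ + 2)).card * η := by rw [sum_const, smul_eq_mul]
    _ ≤ (2 * (θ + 2) + 1) ^ P.d * η := Nat.mul_le_mul_right _ (card_box_le c₀ (θ + 2))

end Boxes

/-! ## §4 The cover: `hsupp`, `htop`, `hread` in the dock's binder shape -/

section Cover

/-- ★★ **px16's (K4) ⟹ THE DOCK's `hsupp`**: if the gen-`n` ancestors of `y` and `q` are within `2` in every coordinate, then `q` lies in the gen-`n` class of a member of the support box
of representatives `nb n y` (namely of `embIter n (blockIter n q)`). [cite: Balaban1987RG1, (0.1)-(0.3) p.251-252] -/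
theorem exists_mem_nb_of_rel_le_two {n : ℕ} (hn : n ≤ P.m + P.K) (y q : Site P 0) (h : ∀ κ, (rel (blockIter n y) (blockIter n q) κ).natAbs ≤ 2) :
    ∃ r ∈ (univ.filter (fun c : Site P n => ∀ κ, (rel (blockIter n y) c κ).natAbs ≤ 2)).image (embIter n),
      q ∈ univ.filter (fun x' : Site P 0 => blockIter (min n (P.m + P.K)) x' = blockIter (min n (P.m + P.K)) r) := by
  refine ⟨embIter n (blockIter n q), ?_, ?_⟩
  · rw [mem_image]
    exact ⟨blockIter n q, by rw [mem_filter]; exact ⟨mem_univ _, h⟩, rfl⟩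
  · rw [mem_cl_embIter_iff hn]

/-- ★ **htop**: `top i ⊆ R = embIter m '' T^{(m)}`. [folklore] -/
theorem top_subset_R {m : ℕ} {ι : Type*} (ends : ι → Finset (Site P m)) (θ : ℕ) (i : ι) :
    (univ.filter (fun c : Site P m => ∃ e ∈ ends i, ∀ κ, (rel e c κ).natAbs ≤ θ + 2)).image (embIter m) ⊆ (univ : Finset (Site P m)).image (embIter m) :=
  image_subset_image (filter_subset _ _)

/-- ★★★ **THE READ-CELL COVER (the dock's `hread`)**: if `y ∈ read n i` (a representative of a gen-`n` cell within `θ` of a site blocking into the ends of `i`) and `r ∈ nb n y` (a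
representative of a gen-`n` cell within `2` of `y`'s), `n ≤ m ≤ m_P + K_P`, then `r` lies in the gen-`m` class of a member of `top i`: at level `n` the cell of `r` is within `θ + 2` of the
witness's (triangle inequality), and `⌊·∕L⌋` iterated up to level `m` does not expand distances (§2). [cite: Balaban1987RG1, (0.1)-(0.3) p.251-252; Balaban1985Averaging, Prop. 4 (128)-(135) p.37-38] -/
theorem read_cover {m : ℕ} (hm : m ≤ P.m + P.K) {ι : Type*} (ends : ι → Finset (Site P m)) (θ : ℕ) {n : ℕ} (hnm : n ≤ m) (i : ι) (y : Site P 0)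
    (hy : y ∈ (univ.filter (fun Y : Site P n => ∃ z : Site P 0, blockIter m z ∈ ends i ∧ ∀ κ, (rel (blockIter n z) Y κ).natAbs ≤ θ)).image (embIter n))
    (r : Site P 0) (hr : r ∈ (univ.filter (fun c : Site P n => ∀ κ, (rel (blockIter n y) c κ).natAbs ≤ 2)).image (embIter n)) :
    ∃ r₀ ∈ (univ.filter (fun c : Site P m => ∃ e ∈ ends i, ∀ κ, (rel e c κ).natAbs ≤ θ + 2)).image (embIter m),
      r ∈ univ.filter (fun x' : Site P 0 => blockIter (min m (P.m + P.K)) x' = blockIter (min m (P.m + P.K)) r₀) := by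
  have hn : n ≤ P.m + P.K := hnm.trans hm
  rw [mem_image] at hy hr
  obtain ⟨Y, hY, rfl⟩ := hy
  obtain ⟨c, hc, rfl⟩ := hr
  rw [mem_filter] at hY hc
  obtain ⟨z, hz, hzY⟩ := hY.2
  have hc2 := hc.2
  rw [blockIter_embIter n hn] at hc2
  -- at level `n`: the cell `c` of `r` is within `θ + 2` of the witness's cell `blockIter n z`
  have hzc : ∀ κ, (rel (blockIter n z) (blockIter n (embIter n c)) κ).natAbs ≤ θ + 2 := by
    intro κ
    rw [blockIter_embIter n hn]
    calc (rel (blockIter n z) c κ).natAbs ≤ (rel (blockIter n z) Y κ).natAbs + (rel Y c κ).natAbs := natAbs_rel_le_add _ _ _ _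
      _ ≤ θ + 2 := add_le_add (hzY κ) (hc2 κ)
  -- up to level `m`
  have hm' : ∀ κ, (rel (blockIter m z) (blockIter m (embIter n c)) κ).natAbs ≤ θ + 2 :=
    fun κ => natAbs_rel_blockIter_mono hnm hm z (embIter n c) κ (hzc κ)
  refine ⟨embIter m (blockIter m (embIter n c)), ?_, ?_⟩
  · rw [mem_image]
    refine ⟨blockIter m (embIter n c), ?_, rfl⟩
    rw [mem_filter]
    exact ⟨mem_univ _, blockIter m z, hz, hm'⟩
  · rw [mem_cl_embIter_iff hm]

/-- ★★ **THE COVER IN THE DOCK's QUANTIFIER ORDER** (`∀ n ≤ m, ∀ i, ∀ y ∈ read n i, ∀ r ∈ nb n y, ∃ r₀ ∈ top i, r ∈ cl m r₀`). [cite: Balaban1985Averaging, Prop. 4 (128)-(135) p.37-38] -/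
theorem read_cover' {m : ℕ} (hm : m ≤ P.m + P.K) {ι : Type*} (ends : ι → Finset (Site P m)) (θ : ℕ) :
    ∀ n ≤ m, ∀ (i : ι), ∀ y ∈ (univ.filter (fun Y : Site P n => ∃ z : Site P 0, blockIter m z ∈ ends i ∧ ∀ κ, (rel (blockIter n z) Y κ).natAbs ≤ θ)).image (embIter n),
      ∀ r ∈ (univ.filter (fun c : Site P n => ∀ κ, (rel (blockIter n y) c κ).natAbs ≤ 2)).image (embIter n),
        ∃ r₀ ∈ (univ.filter (fun c : Site P m => ∃ e ∈ ends i, ∀ κ, (rel e c κ).natAbs ≤ θ + 2)).image (embIter m),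
          r ∈ univ.filter (fun x' : Site P 0 => blockIter (min m (P.m + P.K)) x' = blockIter (min m (P.m + P.K)) r₀) :=
  fun _ hnm i y hy r hr => read_cover hm ends θ hnm i y hy r hr

end Cover

end Summit.QuantumFields.YangMills.Theorems.FluctuationComparisonRegPrIntLS2BetaTorusCellClasses
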